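import Mathlib.NumberTheory.LegendreSymbol.JacobiSymbol
import Summits.BirchSwinnertonDyer.BirchSwinnertonDyer.Theses.PrintX11a
import Summits.BirchSwinnertonDyer.BirchSwinnertonDyer.Theorems.PrintX11aUpperNonSurjFiveTwoCores
import Literature.NumberTheory.EllipticCurves.QuadraticTwist
import HarnessLib

/-!
# Line «realtoric5» for crux U5 = `PrintX11a.UpperNonSurjFive` (item `stmt-BirchSwinnertonDyer-20614`)

bsd-idea-6 g21, lens «decomp» (technique: COMPUTE ONE THING TWO WAYS on the INDEFINITE side with a REAL quadratic torus —
Waldspurger's period formula for the closed geodesics of `K = ℚ(√d)`, `d > 0`, on the Shimura curve `X^T` read against the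
Ribet–Takahashi degree formula), CRUX-LEVEL ONLY (D-0152 ∕ W-71; W-79 publish-only: this file is PUBLISHED with
`ledger crux write`, never `skeleton check`ed — the line of record is «gl1cartan5» rev 12, whose TWO open cores are
`stub_shaExponentCore` (C_Ш: `Ш(E)[p] ≠ 0`) and `stub_tamagawaDepthCore` (C_cc: `Ш(E)[p] = 0 ∧ ord_p ∏ c_ℓ ≥ 2`)).
BSD is not proved by any of this.

REV 2 (bsd-idea-6 g22, critic V#165 PASS-WITH-PRICE paid; stubs and proofs byte-identical to rev 1 sha16 `56bc4426278d5bba`): P1 falsifier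
honesty labels (F1)–(F3) in §Stubs below and in S1ʳ₂'s docstring; P2 the decomposition-payoff sentence marked «CLAIMED, NOT KERNEL-BACKED»
(habitat Props typed, unproved); n1 the landed Negative lemma `Theorems/UpperNonSurjFive/Negative/GSDepthInstrumentVacuous.lean` (p710098)
is acknowledged — it kills the Greenberg–Stevens depth instrument and no statement of this file is an instance of it.

## Idea — the other sign of Waldspurger's square class

«grossdef5» (g14) computed `L(E,1)·L(E^d,1)` for an IMAGINARY `d` through Gross points on a DEFINITE quaternion algebra ramified
at an ODD set `T ⊇ S` of inert multiplicative primes (`S` = the split-multiplicative primes = the `p`-Tamagawa carriers on U5), and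
read it against Takahashi's degree formula: `ord_p Ш_an(E) + ord_p Ш_an(E^d) = 2·ord_p P_K ≥ 0` (★★).  Parity locks it out of
the EVEN-LOCKED pairs (`GrossDef.EvenLocked`: every multiplicative prime split, evenly many) — and BOTH depth-≥-2 census pairs
(`118080ds1`: `S = {5, 41}`; `346560lh1`: `S = {3, 5}`, `p = 5`) are even-locked.  The repair census (cruxlead g8, row B1.5) tried
the indefinite algebra with `K` imaginary: `ε(E/K) = −1`, a Heegner point, a rank-ONE twin — no rank-0 identity.  THIS LINE takes
`K` REAL: `d > 1` an odd fundamental discriminant with `(d, N) = 1`, every split carrier INERT in `K`, every other bad prime split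
(or inert-multiplicative), `T :=` the inert bad primes, `#T` EVEN `≥ 2`, and an anchor `q₀ ∈ T`, `q₀ ≢ 1 (mod p)` (`q₀ = p`
qualifies when `p ∈ T`; in both census pairs `p = 5 ∈ S ⊆ T`).  Then:
* SIGN: `w(E^d) = w(E)·χ_d(−N) = w(E)·(+1)·(−1)^{#T} = w(E) = +1` (`χ_d` even for `d > 0`; inert primes are `∥ N`), so
  `ε(E/K) = +1` with BOTH `L(E,1)`, `L(E^d,1)` central values of sign `+1` — a RANK-ZERO pair, no Heegner point;
* ALGEBRA: by Tunnell–Saito (Yuan–Zhang–Zhang Thm. 1.3) the toric functional lives on the division side exactly at the inert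
  Steinberg primes `T` and on the matrix side at `∞` (which SPLITS in the real field `K`): `B = B_T`, the INDEFINITE quaternion
  algebra ramified exactly at `T` (`#T` even), `X^T` its Shimura curve with Eichler level `N ∕ ∏T`, `φ_B : X^T → E_B` an optimal
  quotient in the isogeny class (`p'`-isogenous to `E` by `Irr`), `f_B` the Jacquet–Langlands transfer normalised by
  `φ_B^*ω_{E_B} = 2πi·f_B(z)dz` (no `q`-expansion, hence no Manin constant on `X^T`);
* PERIOD FORMULA: Waldspurger's formula for the REAL torus `K^× \ 𝔸_K^×` (abstractly Yuan–Zhang–Zhang Thm. 1.4, valid for ANY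
  quadratic `K ∕ F`; explicitly Martin–Whitehouse 2009 Thm. 4.1 for the Gross–Prasad test vector, any `F`, `K`, `B` with disjoint
  ramification — here the character is trivial; Popa 2006 is the case `B = M₂(ℚ)`): `L(E,1)·L(E^d,1) ≐ (f_B, f_B)·|P_K(f_B)|²·(explicit
  local constants)`, where `P_K(f_B) = Σ_{𝔞 ∈ Cl⁺(K)} ∫_{γ_𝔞} 2πi f_B(z) dz` is a sum of integrals over the CLOSED GEODESICS `γ_𝔞 ⊂ X^T`
  of the optimal embeddings `𝒪_K ↪ R` — so `P_K(f_B) = Σ_𝔞 ∫_{φ_B(γ_𝔞)} ω_{E_B} ∈ Λ_{E_B}`, the Néron lattice, BY CONSTRUCTION, and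
  `(f_B, f_B) ≐ deg φ_B · covol(Λ_{E_B})`;
* DEGREE FORMULA: `deg φ_N ∕ deg φ_B ≐ ∏_{r ∈ T} #Φ_r = ∏_{r∈T} v_r(Δ)` up to `p`-units (Ribet–Takahashi 1997 Thm. 1 ∕ Prop. 2 — the
  two-prime switches `X₀^D(M) ↔ X₀^{Dqq'}(M∕qq')` are RT's ORIGINAL indefinite setting; non-squarefree cofactor: Pasten 2024
  Prop. 6.13; `p`-part of the switch factors: the anchor, Pasten 2024 Lemmas 6.14–6.18, junction (c3) of «kolyhoriz5»; `p ∤ i` at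
  each step: Takahashi 2001 Thm. 2.7).
Reading both sides through the BSD-shaped `Ш_an` (Mazur `p ∤ c_{E₀}` at `p ∥ N`; Pal 2012: `Ω⁺(E^d)·√d ∕ Ω⁺(E)` supported at `2` for
`(d,N) = 1`; Cassels: isogeny invariance inside the class, all isogenies prime to `p` by `Irr`; `p ∤ #tors` by `Irr`; at an inert
`r ∈ T` exactly ONE of `E, E^d` is split multiplicative with `c_r = v_r(Δ)`, the other has `c_r ∈ {1,2}`; at a split bad prime
`c_q(E) = c_q(E^d)` is a `p`-unit because the carriers are inert): the `p`-part `p^{Σ_{r∈T} ord_p v_r(Δ)}` of `∏c(E)·∏c(E^d)`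
CANCELS EXACTLY against the degree ratio, leaving
(★★ʳ)  `ord_p Ш_an(E) + ord_p Ш_an(E^d) = 2·ord_p M_K(E) ≥ 0`,  `M_K(E) := P_K(f_B) ∕ Ω⁺(E_B)`.
ENGINE (real proof below, the same three lines as «grossdef5»): (★★ʳ) + a `p`-MINIMAL real twin (`ord_p Ш_an(E^d) ≤ 0`,
`r_an(E^d) = 0`) + `Ш(E)[p] = 0` (given on C_cc) ⟹ `0 ≤ ord_p Ш_an(E) = ord_p #Ш_an − 0` ⟹ `MissingUpperBoundAt` through the lead's door
`ClassX11a.missingUpperBoundAt_of_noPTorsion`.  Tamagawa-EXACT (a SUM of exponents, not Jetchev's max), small-image tolerant (no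
Euler system, no Kolyvagin prime, no `μ`-invariant: Waldspurger ∕ Jacquet–Langlands ∕ Ribet–Takahashi do not see the image of `ρ̄`),
and it lands on the EVEN-LOCKED pairs with `T = S`.

## The decomposition (lens «decomp») and the complementarity with «grossdef5»

C_cc `=` (pairs WITH a real twin datum: S1ʳ + S2ʳ, the engine) `⊔` (pairs WITHOUT one: residual S3ʳ, NOT attacked).  A real datum
exists iff `#S + #(non-split multiplicative primes one may add to T)` can be made EVEN with an anchor; a definite datum («grossdef5»)
iff ODD.  Since `p ∥ N` is itself multiplicative on X11a: `p ∈ S` ⟹ the anchor is free and `T = S` (real, `#S` even) or `T = S`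
(definite, `#S` odd); `p ∉ S` ⟹ `p` is an addable non-split prime AND an anchor: `T = S ∪ {p}` on the odd side.  Hence, modulo the
anchorless exotic configurations, EVERY C_cc pair carries a definite or a real datum — «CLAIMED, NOT KERNEL-BACKED» (rev 2, V#165 P2:
the habitat Props `RealDatumOfSplitEven` ∕ `RealDatumOfNonsplitOdd` below and «grossdef5»'s `DatumOfSplitOdd` ∕ `DatumOfNonsplitEven` are
TYPED but UNPROVED in both files; CRT + Dirichlet, left to provers `--supports`) — so that the Tamagawa-depth core would reduce ENTIRELY to
TWIN SUPPLY — «grossdef5» S2 (imaginary) on `GrossDef`'s habitat, S2ʳ (real) here — with no congruence, no Euler system, no `μ`.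
The residual S3ʳ of THIS file is «grossdef5»'s habitat `∪` the exotic locus; «grossdef5»'s residual `NoDatumResidual` (even-locked
`∪` exotic) is THIS file's habitat `∪` the exotic locus.

## Stubs (6) — S0 print ×13 · S1ʳ₂ the pair identity at `#T = 2` (ONE Ribet–Takahashi switch; print-composite; the census shape)
· S1ʳ₄ the pair identity at `#T ≥ 4` (iterated switches; print-adjacent) · S2ʳ a `p`-minimal REAL twin exists (KEY research stub:
horizontal `p`-indivisibility of REAL quadratic twists with prescribed splitting at a fixed `p ∥ N`; per pair a finite modular-symbol
computation; Prasanna 2008 ∕ 2010, Ono–Skinner, Bruinier–Ono give it only at `p ∤ N`) · S3ʳ residual (no real datum; = «grossdef5»'s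
habitat; NOT attacked) · S4 residual (C_Ш verbatim; NOT attacked).  Composition: the record's rev-12 turnkey
`GL1Cartan.upperNonSurjFive_of_elevenFacts_of_twoCores` BY NAME.

## Honest open constants (inside S1ʳ, named so the critic can price them)
(Hʳ1) the explicit local constants of Martin–Whitehouse Thm. 4.1 at the bad primes, after rewriting the Tamagawa-measure Petersson
norm on `B_T^×` as `deg φ_B · covol(Λ_{E_B})`, are `p`-units (BSD-consistency across all admissible `d` says the carrier factors
cancel; a stray `(ℓ ± 1)` at a carrier `ℓ ≡ ∓1 (mod p)` is the failure mode — `41 ≡ 1 (mod 5)` at `118080ds1` is the instrument);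
(Hʳ2) the Ribet–Takahashi exponent identity at `r = p ∈ T` with non-squarefree cofactor (the same joint «grossdef5» S1 carries, accepted
with the anchor, V#141); (Hʳ3) `M_K(E)² ∈ ℚ` and `p`-integral: `P_K ∈ Λ_{E_B}` exactly (closed cycles), reality of the `Cl⁺(K)`-sum
up to the orientation involution.  FALSIFIERS (rev 2, V#165 P1 — honesty labels): (F1) «[KIT-M, ONE-SIDED: BSD-parity sanity only]» PARI
`lfun` ∕ modular symbols for `L(E^d,1)` at the least data (`118080ds1`: `d = 97`; `346560lh1`: `d = 17`): S1ʳ is BSD-implied and the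
square parity of `Ш_an(E^d)` is already forced by BSD + Cassels–Tate, so NO outcome consistent with BSD discriminates the constant chain
(Hʳ1)–(Hʳ3); it can only catch a gross bookkeeping slip.  (F2) «[KIT-L, TWO-WAYS]» the genuine test computes the TORIC side
`M_K = P_K(f_B)/Ω⁺` on the NON-SPLIT Shimura curve `X^{205}_0(2⁶·3²)` (no `q`-expansions) independently and compares with
`L(E,1)L(E^{97},1)`: computable routes, each weeks not minutes — (i) the `d`-th Fourier coefficient of the weight-`3/2` Shintani-type
lift of the Jacquet–Langlands transfer `f_B` (Prasanna 2008; `f_B` itself by Voight's fundamental-domain ∕ Hecke-module algorithms for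
indefinite quaternion orders), (ii) direct closed-geodesic integration of `f_B` over the `Cl⁺(ℚ(√97))`-cycles on a computed fundamental
domain of `X^{205}_0(576)` (power-series expansions à la Voight–Willis), (iii) `5`-adically via the Čerednik–Drinfeld uniformisation at
the anchor `5 ∣ 205`.  (F3) «[desk ∕ KIT-S, CALIBRATION, off-habitat]» Popa's split case `B = M₂` (`T = ∅`, every bad prime split in
`K`): both sides by classical modular symbols (`Σ_{𝔞∈Cl⁺K} ∫_{γ_𝔞} f` vs `L(E,1)L(E^d,1)`) on any rank-0 optimal curve — validates exactly
the imported constant chain (torus volume `L(1,η)²` ↔ regulator, `√d` ↔ Pal's `Ω⁺(E^d)`, covolume, `2`-powers) before it is trusted on `X^T`.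
-/

set_option linter.dupNamespace false
set_option autoImplicit false

noncomputable section

open scoped Classical

open WeierstrassCurve
  Literature.NumberTheory.EllipticCurves
  Literature.NumberTheory.EllipticCurves.ModularForms
  Literature.NumberTheory.EllipticCurves.Rank1Residual
  Literature.NumberTheory.EllipticCurves.Rank1Residual.Typed
  Literature.NumberTheory.EllipticCurves.SteinWuthrich2013
  Literature.NumberTheory.EllipticCurves.Kato2004
  Summit.BirchSwinnertonDyer.Rank1Residual
  Summit.BirchSwinnertonDyer.BirchSwinnertonDyer.Theses
  Summit.BirchSwinnertonDyer.BirchSwinnertonDyer.Theorems.GL1Cartan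

namespace Summit.BirchSwinnertonDyer.BirchSwinnertonDyer.Cruxes.UpperNonSurjFive.RealToric

/-! ## §1 The objects: twist models, the splitting symbol, the inert set, the REAL TWIN DATUM -/

/-- `W'` is a model of the quadratic twist of `W` by `d`: `W' ≅_ℚ W^d` (verbatim «grossdef5» ∕ «twinflip5» ∕ «kolyhoriz5»). [folklore] -/
def IsTwistModel (W W' : WeierstrassCurve ℚ) (d : ℤ) : Prop :=
  ∃ C : VariableChange ℚ, C • W' = W.quadraticTwist (d : ℚ)

/-- Splitting symbol of the odd discriminant `d ≡ 1 (mod 4)` at a prime `q`: `+1` split, `−1` inert, `0` ramified in `ℚ(√d)`;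
`χ₈(d)` at `q = 2`, the Jacobi symbol `(d/q)` at odd `q` (verbatim «grossdef5»). [folklore] -/
def kron (d : ℤ) (q : ℕ) : ℤ :=
  if q = 2 then ZMod.χ₈ (d : ZMod 8) else jacobiSym d q

/-- The INERT SET `T(W, d)`: the bad primes of `W` inert in `ℚ(√d)` (the ramification of the indefinite quaternion algebra `B_T`).
(verbatim «grossdef5») [folklore] -/
def inertSet (W : WeierstrassCurve ℚ) (d : ℤ) : Finset ℕ :=
  (W.conductorNorm ℤ).primeFactors.filter fun q => kron d q = -1

/-- The split-multiplicative primes of `W` (on the U5 locus: exactly the `p`-Tamagawa carriers; verbatim «grossdef5»). [folklore] -/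
def splitSet (W : WeierstrassCurve ℚ) : Finset ℕ :=
  (W.conductorNorm ℤ).primeFactors.filter fun q => ∃ _ : Fact q.Prime, W.HasSplitMultiplicativeReductionAtPrime q

/-- **REAL TWIN DATUM** for `(W, p)`: a POSITIVE odd fundamental discriminant `d > 1` (`d ≡ 1 (mod 4)`, squarefree; `K = ℚ(√d)`
REAL quadratic, `d_K = d`) such that, in `K`: every bad prime of `W` is UNRAMIFIED (`kron = ±1`, i.e. `(d, N) = 1` — Martin–Whitehouse's
disjoint ramification with the trivial character; it also forces `p ∤ d` since `p ∥ N` on X11a) and is inert only if it is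
MULTIPLICATIVE (`q ∥ N`: Steinberg, the Eichler-order case, and `χ_d(q)^{ord_q N} = −1`); every SPLIT-multiplicative prime (= every
`p`-Tamagawa carrier on U5, `q = p` included when `E` is split at `p`) is INERT; the inert set `T` has EVEN size `≥ 2` (so
`w(E^d) = w(E)`, `ε(E/K) = +1` with BOTH signs `+1` when `r_an(E) = 0`, and the algebra `B_T` given by Tunnell–Saito is INDEFINITE:
`∞` splits in the real field); and an ANCHOR `q₀ ∈ T` with `q₀ ≢ 1 (mod p)` (it makes the Ribet–Takahashi switch factors `p`-units —
junction (c3) of «kolyhoriz5», Pasten 2024; `q₀ = p` qualifies whenever `p ∈ T`; needed already at `#T = 2`, which is one switch).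
No class-number ∕ fundamental-unit clause: the torus measure is Waldspurger's, no unit of `K` enters the `p`-adic reading for `p ≥ 5`.
[cite: MartinWhitehouse2008, Thm. 4.1 (IMRN 2009 pp. 176–177) and §1 p. 144] [cite: PastenShimura2024, Prop. 6.13 (shape of the anchor)] -/
def RealTwinDisc (W : WeierstrassCurve ℚ) (p : ℕ) (d : ℤ) : Prop :=
  1 < d ∧ Squarefree d ∧ d % 4 = 1 ∧
    (∀ (q : ℕ) [Fact q.Prime], q ∣ W.conductorNorm ℤ →
      kron d q = 1 ∨ (kron d q = -1 ∧ W.HasMultiplicativeReductionAtPrime q)) ∧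
    (∀ (q : ℕ) [Fact q.Prime], q ∣ W.conductorNorm ℤ →
      W.HasSplitMultiplicativeReductionAtPrime q → kron d q = -1) ∧
    Even (inertSet W d).card ∧ 2 ≤ (inertSet W d).card ∧
    (∃ q₀ ∈ inertSet W d, q₀ % p ≠ 1)

/-- **The ODD-LOCKED locus** (support notion, informational — the mirror of `GrossDef.EvenLocked`): every multiplicative prime of `W`
is SPLIT multiplicative and there are oddly many.  On it no real twin datum exists (an even inert set made of multiplicative primes and
containing all split-multiplicative ones is impossible); parity forces the DEFINITE algebra — the home of «grossdef5» (`T = S`, anchor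
`p ∈ S`).  Neither depth-≥-2 census pair lies here (both are even-locked, i.e. in THIS line's habitat). [folklore] -/
def OddLocked (W : WeierstrassCurve ℚ) : Prop :=
  (∀ (q : ℕ) [Fact q.Prime], q ∣ W.conductorNorm ℤ →
      W.HasMultiplicativeReductionAtPrime q → W.HasSplitMultiplicativeReductionAtPrime q) ∧
    Odd (splitSet W).card

/-! ## §2 The statements of the line -/

/-- **S0 — the thirteen named print facts of the record's turnkey `GL1Cartan.upperNonSurjFive_of_elevenFacts_of_twoCores`, as ONE
conjunction BY NAME** (verbatim the conjunction `PrintFacts` of «oldprod5» ∕ «grossdef5»: Stein–Wuthrich 6.1 ×2, Kato 12.4, modularity,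
Kato §17.13 ×3, Mazur 1978 Cor. 4.1, GZK, Coleman–Edixhoven 1998 Thm. 2.1, Greenberg–Vatsal 2000 §3, Ribet 1984 Thm. 4.1,
Darmon–Diamond–Taylor 3.15). [cite: Kato2004Asterisque, Thm. 12.4 and §17.13] [cite: SteinWuthrich2013, Thm. 6.1]
[cite: DarmonDiamondTaylor1995, Thm. 3.15] -/
def PrintFacts : Prop :=
  Literature.NumberTheory.EllipticCurves.SteinWuthrich2013.thm61_splitMultiplicative ∧
    Literature.NumberTheory.EllipticCurves.SteinWuthrich2013.thm61_nonsplitMultiplicative ∧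
    Literature.NumberTheory.EllipticCurves.Kato2004.thm12_4 ∧
    Literature.NumberTheory.EllipticCurves.ModularForms.exists_isNewformOf ∧
    Literature.NumberTheory.EllipticCurves.Kato2004.exists_multDivisibilityInputs_nonsplit_contra ∧
    Literature.NumberTheory.EllipticCurves.Kato2004.exists_multDivisibilityInputs_split_contra ∧
    Literature.NumberTheory.EllipticCurves.Kato2004.exists_multDivisibilityInputs_fine_contra ∧
    Literature.NumberTheory.EllipticCurves.ModularForms.mazur_not_dvd_maninConstant_of_odd ∧
    rank_eq_analyticRank_of_analyticRank_le_one ∧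
    colemanEdixhoven1998_heckePolynomial_simpleRoots ∧ greenbergVatsal2000_plusSymbol_congruence ∧
    ribet1984_iharaLemma ∧ ribet1990_levelLowering_gamma0_newform_general_of_five_le

/-- **S1ʳ₂ — THE REAL TORIC PAIR IDENTITY (★★ʳ) AT TWO INERT PRIMES (`#T = 2`; ONE Ribet–Takahashi switch `X₀(N) ↔ X₀^{ℓ₁ℓ₂}(N∕ℓ₁ℓ₂)`;
print-composite; the census shape `T = S = {ℓ₁, ℓ₂} ∋ p`).**  For a minimal `E/ℚ` in class X11a at a non-surjective `p ≥ 5`, a real twin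
datum `d` with `#T = 2`, and a globally minimal model `W'` of `E^d` with `r_an(E^d) = 0`: `Ш_an(E)`, `Ш_an(E^d)` are rational and
`ord_p Ш_an(E) + ord_p Ш_an(E^d) ≥ 0` — in fact `= 2·ord_p M_K(E)`, `M_K(E) = P_K(f_B) ∕ Ω⁺(E_B)`, `P_K(f_B) = Σ_{𝔞∈Cl⁺(K)} ∫_{φ_B(γ_𝔞)} ω_{E_B}
∈ Λ_{E_B}` the sum of the Néron periods of the closed geodesics of `K` on the Shimura curve `X^{ℓ₁ℓ₂}` of Eichler level `N ∕ ℓ₁ℓ₂`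
(ARBITRARY — on U5 never squarefree).  CHAIN, every link print: Waldspurger for the real torus (Yuan–Zhang–Zhang Thm. 1.4, any quadratic
`K`; explicitly Martin–Whitehouse Thm. 4.1, trivial character, disjoint ramification; Tunnell–Saito = YZZ Thm. 1.3 places the functional
on `B_T`) · Jacquet–Langlands + multiplicity one for the `f_E`-line on `X^T` · `(f_B,f_B) ≐ deg φ_B·covol(Λ_{E_B})` for the Néron-normalised
transfer · Ribet–Takahashi 1997 Thm. 1 ∕ Prop. 2 for the switch (`#Φ_{ℓ₁}·#Φ_{ℓ₂}`, cofactor not squarefree: Pasten 2024 Prop. 6.13; switch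
factor a `p`-unit by the anchor: Lemmas 6.14, 6.15, 6.18; `p ∤ i`: Takahashi 2001 Thm. 2.7) · Mazur `p ∤ c_{E₀}` · Pal 2012 (period of the
real twist, `(d,N)=1`, supported at `2`) · Cassels 1965 (isogeny invariance, isogenies prime to `p` by `Irr`) · `p ∤ #tors(E)·#tors(E^d)`
(`Irr`, `E^d[p] ≅ E[p] ⊗ χ_d`) · the carrier bookkeeping of the file header (at inert `r` exactly one of `E, E^d` is split with
`c_r = v_r(Δ)`).  NOT the crux in disguise: implied by U5 applied to `E` and to `E^d` (again an X11a `¬Surj` pair), strictly weaker; it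
bounds `Ш_an`, never `#Ш`.  WHY IT MIGHT FAIL: (Hʳ1) a non-unit local constant of Martin–Whitehouse at a carrier `ℓ ≡ ±1 (mod p)`
surviving the measure rewriting (`41 ≡ 1 (mod 5)` at `118080ds1` is the instrument); (Hʳ2) the RT exponent at `r = p ∈ T` with
non-squarefree cofactor; (Hʳ3) reality ∕ integrality of the `Cl⁺(K)`-sum.  Cheapest falsifier (rev 2 labels, V#165 P1): the
genuine one is the «[KIT-L, TWO-WAYS]» computation of the TORIC side `M_K` on `X^{205}_0(576)` (Shintani-lift coefficient ∕ geodesic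
integration ∕ Čerednik–Drinfeld `5`-adic periods; header (F2)) against `L(E,1)L(E^{97},1)` at `118080ds1` (`K = ℚ(√97)`,
`T = S = {5, 41}`, anchor `5`; at `346560lh1`, `S = {3, 5}`, `19² ∣ N`, the first datum is `d = 17`); the PARI `lfun` square-parity check of
`Ш_an(E^d)` alone is «[KIT-M, ONE-SIDED: BSD-parity sanity only]» (header (F1)); calibration in Popa's split case is (F3).
[cite: MartinWhitehouse2008, Thm. 4.1] [cite: Popa2006, Thm. 1 (case B = M₂)] [cite: Waldspurger1985]
[cite: RibetTakahashi1997, Thm. 1 and Prop. 2] [cite: PastenShimura2024, Prop. 6.13, Lemmas 6.14, 6.15, 6.18] [cite: Takahashi2001, Thm. 2.7 (p. 80)]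
[cite: Mazur1978, Cor. 4.1] [cite: Pal2012] [cite: Cassels1965, Thm. 1.3] [cite: Agashe2010IJNT, Thm. 3.2] [cite: Miller2011LMS, Def. 1.1] -/
def RealToricPairTwo : Prop :=
  ∀ (W : WeierstrassCurve ℚ) [W.IsElliptic] [W.IsGloballyMinimal] (p : ℕ) [Fact p.Prime],
    ClassX11a W p → ¬ Surj W p → 5 ≤ p →
    ∀ (d : ℤ) (W' : WeierstrassCurve ℚ) [W'.IsElliptic] [W'.IsGloballyMinimal],
      RealTwinDisc W p d → IsTwistModel W W' d → W'.analyticRank = 0 → (inertSet W d).card = 2 →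
      ∃ q q' : ℚ, shaAn W = (q : ℂ) ∧ shaAn W' = (q' : ℂ) ∧ 0 ≤ padicValRat p q + padicValRat p q'

/-- **S1ʳ₄ — THE REAL TORIC PAIR IDENTITY (★★ʳ) WITH ITERATED SWITCHES (`#T ≥ 4`, even; print-ADJACENT).**  The same conclusion for a
real twin datum with `#T ≥ 4`: the degree side `ord_p(deg φ_N ∕ deg φ_{B_T}) = Σ_{r∈T} ord_p v_r(Δ)` needs `#T∕2` Ribet–Takahashi switches
`X₀^D(M) ↔ X₀^{Dqq'}(M∕qq')` with `D > 1` at the later steps (printed for `D > 1`; the anchor gives ONE good prime per switch when the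
switches are ordered through `q₀` — to be re-read at `D > 1` with non-squarefree cofactor, exactly «grossdef5» joint (J3)).  The generic
shape off the census: `p` non-split, split carriers `q₁, q₂, q₃` (three, odd) plus `p`: `T = {q₁, q₂, q₃, p}`, anchor `p`.  WHY IT MIGHT
FAIL: a `p` in a switch factor at a step whose two primes are both `≡ 1 (mod p)`; plus (Hʳ1)–(Hʳ3) of S1ʳ₂.
[cite: RibetTakahashi1997, Thm. 1 and Prop. 2] [cite: PastenShimura2024, Prop. 6.13, Lemmas 6.14, 6.15, 6.18]
[cite: Takahashi2001, Thm. 2.7 (p. 80)] [cite: MartinWhitehouse2008, Thm. 4.1] [cite: Miller2011LMS, Def. 1.1] -/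
def RealToricPairSwitch : Prop :=
  ∀ (W : WeierstrassCurve ℚ) [W.IsElliptic] [W.IsGloballyMinimal] (p : ℕ) [Fact p.Prime],
    ClassX11a W p → ¬ Surj W p → 5 ≤ p →
    ∀ (d : ℤ) (W' : WeierstrassCurve ℚ) [W'.IsElliptic] [W'.IsGloballyMinimal],
      RealTwinDisc W p d → IsTwistModel W W' d → W'.analyticRank = 0 → 4 ≤ (inertSet W d).card →
      ∃ q q' : ℚ, shaAn W = (q : ℂ) ∧ shaAn W' = (q' : ℂ) ∧ 0 ≤ padicValRat p q + padicValRat p q'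

/-- **S1ʳ — THE REAL TORIC PAIR IDENTITY (★★ʳ) (assembled: S1ʳ ⟸ S1ʳ₂ + S1ʳ₄ by `realToricPair_of_two_of_switch`, since `#T` is even
`≥ 2`).**  For a minimal `E/ℚ` in class X11a at a non-surjective `p ≥ 5`, a real twin datum `d`, and a globally minimal model `W'` of
`E^d` with `r_an(E^d) = 0`: `Ш_an(E)`, `Ш_an(E^d)` are rational and `ord_p Ш_an(E) + ord_p Ш_an(E^d) ≥ 0`.  BSD-implied (U5 on `E` and on
`E^d`), strictly weaker than the crux. [cite: MartinWhitehouse2008, Thm. 4.1] [cite: RibetTakahashi1997, Thm. 1] [cite: Miller2011LMS, Def. 1.1] -/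
def RealToricPair : Prop :=
  ∀ (W : WeierstrassCurve ℚ) [W.IsElliptic] [W.IsGloballyMinimal] (p : ℕ) [Fact p.Prime],
    ClassX11a W p → ¬ Surj W p → 5 ≤ p →
    ∀ (d : ℤ) (W' : WeierstrassCurve ℚ) [W'.IsElliptic] [W'.IsGloballyMinimal],
      RealTwinDisc W p d → IsTwistModel W W' d → W'.analyticRank = 0 →
      ∃ q q' : ℚ, shaAn W = (q : ℂ) ∧ shaAn W' = (q' : ℂ) ∧ 0 ≤ padicValRat p q + padicValRat p q'

/-- **S2ʳ — A `p`-MINIMAL REAL TWIN EXISTS (KEY research stub; the analytic half).**  For every C_cc pair (`Ш(E)[p] = 0`, `ord_p ∏c ≥ 2`)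
admitting SOME real twin datum, there is a real twin datum `d` and a globally minimal model `W'` of `E^d` with `r_an(E^d) = 0` and
`ord_p Ш_an(E^d) ≤ 0`.  By (★★ʳ) this is «`p ∤ M_K(E)` for some admissible real `K`»: a HORIZONTAL `p`-indivisibility of real toric
periods ∕ of `L(E^d,1)^{alg}` in the family of POSITIVE discriminants with prescribed splitting at the bad primes (`w(E^d) = +1` is
automatic for the datum, `r_an(E^d) ∈ {0, 2, …}`).  Per pair it is a FINITE modular-symbol computation (BSD-free); class-wide it is OPEN
at a fixed exceptional `p ∣ N`: Prasanna 2008 (integrality of the quaternionic Shimura–Shintani–Waldspurger lift, whose `d`-th Fourier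
coefficients for `d > 0` ARE the geodesic periods `P_{ℚ(√d)}(f_B)`, and `p`-indivisibility of some coefficient) and Prasanna 2010 p. 400,
Ono–Skinner 1998 Cor. 3, Bruinier–Ono 2003 Cor. 2, Bruinier 1999 supply unit twists only for `p ∤ N` and without the splitting
constraints.  THE ONE STRUCTURAL FAILURE MODE: S2ʳ fails at `(E, p, T)` ⟺ `p ∣ M_K(E)` for every admissible real `K` ⟺ the weight-3∕2
quaternionic SHINTANI LIFT of the reduced transfer `f̄_B` VANISHES `mod p` on the admissible square-class progressions of positive `d` —
a Sturm-type finite certificate per pair.  The hypotheses `Ш(E)[p] = 0`, `ord_p ∏c ≥ 2` only SCOPE the statement to C_cc.  DISTINCT from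
«grossdef5» S2 (imaginary `d`, Gross points, theta series of the definite algebra), «kolyhoriz5» S2 (rank-ONE twin), «twinflip5»
(definite at `{p, ∞}`, carriers uncompensated), «sqparity5» (real square class used for the PARITY of `ord_p #Ш` on C_Ш only).
WHY IT MIGHT FAIL: `p`-adic degeneracy of the Shintani lift of `f̄_B` on the admissible progressions (the real face of «`p`-Eisenstein
toric periods» at primes where `ρ̄` is unramified, hypothesis CR of Pollack–Weston failing at every `r ∈ T`), certified at a census pair.
[cite: Prasanna2008, Thm. 1.2 and §5] [cite: Prasanna2010CJM, p. 400] [cite: OnoSkinner1998, Cor. 3] [cite: BruinierOno2003, Cor. 2]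
[cite: Bruinier1999Duke, Thm. 1] [cite: PollackWeston2011, Thm. 6.8 hypothesis CR] [cite: Sturm1987] [cite: Miller2011LMS, Def. 1.1] -/
def MinimalRealTwin : Prop :=
  ∀ (W : WeierstrassCurve ℚ) [W.IsElliptic] [W.IsGloballyMinimal] (p : ℕ) [Fact p.Prime],
    ClassX11a W p → ¬ Surj W p → 5 ≤ p → 2 ≤ padicValNat p W.tamagawaProduct →
    (∀ x : W.sha, (p : ℤ) • x = 0 → x = 0) → (∃ d : ℤ, RealTwinDisc W p d) →
    ∃ (d : ℤ) (W' : WeierstrassCurve ℚ) (_ : W'.IsElliptic) (_ : W'.IsGloballyMinimal),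
      RealTwinDisc W p d ∧ IsTwistModel W W' d ∧ W'.analyticRank = 0 ∧
      ∃ q' : ℚ, shaAn W' = (q' : ℂ) ∧ padicValRat p q' ≤ 0

/-- **S3ʳ — RESIDUAL: C_cc ON THE PAIRS WITH NO REAL TWIN DATUM (open; NOT attacked here).**  `=` the ODD-LOCKED locus (`OddLocked`:
every multiplicative prime split, oddly many — parity forces the definite algebra; «grossdef5»'s habitat with `T = S`, anchor `p`) `∪`
the `p`-non-split odd configurations (`T = S ∪ {p}`, again «grossdef5») `∪` the exotic anchorless locus (`p ∉ S`, every `ℓ ∈ S`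
`≡ 1 (mod p)`, no second non-split multiplicative prime).  This is the record's `TamagawaDepthCore` restricted; its attack is «grossdef5»
(definite Gross–Takahashi pair identity + imaginary minimal twin).  NOTE (rev 2, V#165 P2): the sentence «modulo the exotic locus every
C_cc pair has a definite or a real datum» is «CLAIMED, NOT KERNEL-BACKED» — the habitat Props `RealDatumOfSplitEven` ∕
`RealDatumOfNonsplitOdd` (and «grossdef5»'s) are typed but unproved, so this residual is stated by the ABSENCE of a real datum, not by the
parity description.  WHY IT MIGHT FAIL: it is C_cc itself there (BSD-true; open).
[cite: Miller2011LMS, Def. 1.1] [cite: SilvermanATAEC1994, Cor. IV.9.2 (d)] -/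
def NoRealDatumResidual : Prop :=
  ∀ (W : WeierstrassCurve ℚ) [W.IsElliptic] [W.IsGloballyMinimal] (p : ℕ) [Fact p.Prime],
    ClassX11a W p → ¬ Surj W p → 5 ≤ p → 2 ≤ padicValNat p W.tamagawaProduct →
    (∀ x : W.sha, (p : ℤ) • x = 0 → x = 0) → (¬ ∃ d : ℤ, RealTwinDisc W p d) → MissingUpperBoundAt W p

/-- **S4 — RESIDUAL: the record's C_Ш = `ShaExponentCore` VERBATIM («`Ш(E)[p] ≠ 0`»; open; NOT attacked here — (★★ʳ) bounds `Ш_an`,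
never `#Ш`).** [cite: Miller2011LMS, Def. 1.1] -/
def ShaCoreResidual : Prop :=
  ∀ (W : WeierstrassCurve ℚ) [W.IsElliptic] [W.IsGloballyMinimal] (p : ℕ) [Fact p.Prime],
    ClassX11a W p → ¬ Surj W p → 5 ≤ p → (∃ x : W.sha, (p : ℤ) • x = 0 ∧ x ≠ 0) → MissingUpperBoundAt W p

/-- **Support (typed, NOT a stub, not load-bearing): real data exist on the even side, case `p` SPLIT multiplicative** — if the number
of split-multiplicative primes is even (it is `≥ 2` since `p` is one of them... and at least one more carrier exists on C_cc off T1),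
`T = splitSet W` with anchor `p` is realised by some `d` (CRT on the symbols + Dirichlet: `d ≡ 1 (mod 4)` a prime in the prescribed class
mod `8·∏ q`).  This covers BOTH depth-≥-2 census pairs.  STATUS (rev 2, V#165 P2): «CLAIMED, NOT KERNEL-BACKED» — typed, UNPROVED here;
provable from Mathlib (`Nat.setOf_prime_and_eq_mod_infinite`, quadratic reciprocity for `jacobiSym`, CRT); provers may land it
`--supports stmt-BirchSwinnertonDyer-20614`; nothing in §4 uses it. [folklore] -/
def RealDatumOfSplitEven : Prop :=
  ∀ (W : WeierstrassCurve ℚ) [W.IsElliptic] (p : ℕ) [Fact p.Prime], 5 ≤ p →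
    W.HasSplitMultiplicativeReductionAtPrime p → Even (splitSet W).card → 2 ≤ (splitSet W).card →
    ∃ d : ℤ, RealTwinDisc W p d

/-- **Support (typed, NOT a stub, not load-bearing): real data exist on the even side, case `p` NON-SPLIT multiplicative and oddly
many split carriers** — `T = splitSet W ∪ {p}`, anchor `p`. «CLAIMED, NOT KERNEL-BACKED» (rev 2): typed, unproved, provable as
`RealDatumOfSplitEven`. [folklore] -/
def RealDatumOfNonsplitOdd : Prop :=
  ∀ (W : WeierstrassCurve ℚ) [W.IsElliptic] (p : ℕ) [Fact p.Prime], 5 ≤ p →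
    W.HasMultiplicativeReductionAtPrime p → ¬ W.HasSplitMultiplicativeReductionAtPrime p →
    Odd (splitSet W).card → ∃ d : ℤ, RealTwinDisc W p d

/-! ## §3 The stubs (the ONLY `sorry`s of the file; six) -/

/-- STUB S0 (print ×13, XS each: the named facts of the record). -/
theorem stub_printFacts : PrintFacts := by
  sorry

/-- STUB S1ʳ₂ (THE IDENTITY at `#T = 2`; print-composite, L: Martin–Whitehouse Thm. 4.1 × one Ribet–Takahashi switch with the anchor). -/
theorem stub_realToricPairTwo : RealToricPairTwo := by
  sorry

/-- STUB S1ʳ₄ (`#T ≥ 4`; print-adjacent, L: + iterated switches at `D > 1`, joint (J3) of «grossdef5»). -/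
theorem stub_realToricPairSwitch : RealToricPairSwitch := by
  sorry

/-- STUB S2ʳ (KEY research, XL class-wide ∕ decidable per pair: a `p`-minimal REAL twin). -/
theorem stub_minimalRealTwin : MinimalRealTwin := by
  sorry

/-- STUB S3ʳ (residual, open: C_cc on the no-real-datum ∕ odd-locked locus — «grossdef5»'s home). -/
theorem stub_noRealDatumResidual : NoRealDatumResidual := by
  sorry

/-- STUB S4 (residual, open: the record's C_Ш verbatim). -/
theorem stub_shaCoreResidual : ShaCoreResidual := by
  sorry

/-! ## §4 The engine and the composition (real proofs) -/

/-- **S1ʳ ⟸ S1ʳ₂ + S1ʳ₄ (real proof):** the inert set of a real twin datum has EVEN size `≥ 2`, hence size `2` or `≥ 4`.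
[cite: Miller2011LMS, Def. 1.1] -/
theorem realToricPair_of_two_of_switch (h2 : RealToricPairTwo) (h4 : RealToricPairSwitch) :
    RealToricPair := by
  intro W _ _ p _ hX hns hp5 d W' _ _ hd htw hr
  have heven : Even (inertSet W d).card := hd.2.2.2.2.2.1
  have hge2 : 2 ≤ (inertSet W d).card := hd.2.2.2.2.2.2.1
  rcases Nat.lt_or_ge (inertSet W d).card 4 with hlt | hge
  · have h2c : (inertSet W d).card = 2 := by
      obtain ⟨k, hk⟩ := heven
      omega
    exact h2 W p hX hns hp5 d W' hd htw hr h2c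
  · exact h4 W p hX hns hp5 d W' hd htw hr hge

/-- **THE ENGINE (real proof): (★★ʳ) + a `p`-minimal real twin + `Ш(E)[p] = 0` ⟹ `MissingUpperBoundAt`.**
`0 ≤ ord_p Ш_an(E) + ord_p Ш_an(E^d)` and `ord_p Ш_an(E^d) ≤ 0` give `0 ≤ ord_p Ш_an(E)`; with `Ш(E)[p] = 0` (so `ord_p #Ш(E) = 0`,
`Ш` finite by GZK on the class) this is the lead's door `ClassX11a.missingUpperBoundAt_of_noPTorsion`. [cite: Miller2011LMS, Def. 1.1] -/
theorem missingUpperBoundAt_of_realTwin (hGZK : rank_eq_analyticRank_of_analyticRank_le_one)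
    (h1 : RealToricPair) {W : WeierstrassCurve ℚ} [W.IsElliptic] [W.IsGloballyMinimal] {p : ℕ} [Fact p.Prime]
    (hX : ClassX11a W p) (hns : ¬ Surj W p) (hp5 : 5 ≤ p) (hSha : ∀ x : W.sha, (p : ℤ) • x = 0 → x = 0)
    {d : ℤ} {W' : WeierstrassCurve ℚ} [W'.IsElliptic] [W'.IsGloballyMinimal]
    (hd : RealTwinDisc W p d) (htw : IsTwistModel W W' d) (hr : W'.analyticRank = 0)
    {q' : ℚ} (hq' : shaAn W' = (q' : ℂ)) (hmin : padicValRat p q' ≤ 0) : MissingUpperBoundAt W p := by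
  obtain ⟨q, q'', hq, hq'', hsum⟩ := h1 W p hX hns hp5 d W' hd htw hr
  have he : q'' = q' := by exact_mod_cast hq''.symm.trans hq'
  subst he
  exact hX.missingUpperBoundAt_of_noPTorsion hGZK hq (by linarith) hSha

/-- **C_cc from S1ʳ + S2ʳ + S3ʳ (real proof):** split on whether a real twin datum exists. [cite: Miller2011LMS, Def. 1.1] -/
theorem tamagawaDepthCore_of_realtoric (hGZK : rank_eq_analyticRank_of_analyticRank_le_one)
    (h1 : RealToricPair) (h2 : MinimalRealTwin) (h3 : NoRealDatumResidual) :
    ∀ (W : WeierstrassCurve ℚ) [W.IsElliptic] [W.IsGloballyMinimal] (p : ℕ) [Fact p.Prime],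
      ClassX11a W p → ¬ Surj W p → 5 ≤ p → 2 ≤ padicValNat p W.tamagawaProduct →
      (∀ x : W.sha, (p : ℤ) • x = 0 → x = 0) → MissingUpperBoundAt W p := by
  intro W _ _ p _ hX hns hp5 hdeep hSha
  by_cases hex : ∃ d : ℤ, RealTwinDisc W p d
  · obtain ⟨d, W', hE', hM', hd, htw, hr, q', hq', hmin⟩ := h2 W p hX hns hp5 hdeep hSha hex
    exact missingUpperBoundAt_of_realTwin hGZK h1 hX hns hp5 hSha hd htw hr hq' hmin
  · exact h3 W p hX hns hp5 hdeep hSha hex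

/-- **U5 from the hypotheses (real proof): the thirteen prints + S1ʳ + S2ʳ + S3ʳ + S4, through the record's rev-12 turnkey BY NAME.**
[cite: Miller2011LMS, Def. 1.1] -/
theorem UpperNonSurjFive_of_hyps (hP : PrintFacts) (h1 : RealToricPair) (h2 : MinimalRealTwin)
    (h3 : NoRealDatumResidual) (h4 : ShaCoreResidual) : Theses.PrintX11a.UpperNonSurjFive := by
  obtain ⟨hJs, hJn, h12, hnf, hns', hsp', hfine', hMz, hGZK, hCE, hGV, hI, hLL⟩ := hP
  exact upperNonSurjFive_of_elevenFacts_of_twoCores hJs hJn h12 hnf hns' hsp' hfine' hMz hGZK hCE hGV hI hLL h4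
    (tamagawaDepthCore_of_realtoric hGZK h1 h2 h3)

/-- **Composition U5 — the crux BY NAME, stub-fed (real proof; `sorry` only inside the six stubs).** [cite: Miller2011LMS, Def. 1.1] -/
theorem UpperNonSurjFive_of_realtoric : Theses.PrintX11a.UpperNonSurjFive :=
  UpperNonSurjFive_of_hyps stub_printFacts
    (realToricPair_of_two_of_switch stub_realToricPairTwo stub_realToricPairSwitch)
    stub_minimalRealTwin stub_noRealDatumResidual stub_shaCoreResidual

end Summit.BirchSwinnertonDyer.BirchSwinnertonDyer.Cruxes.UpperNonSurjFive.RealToric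

end
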